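import Mathlib
import HarnessLib
import Literature.Analysis.FluidPDE.TsaiMaximumPrinciple
import Literature.Analysis.FluidPDE.LerayProfileCalculus

/-!
# Route `PoloidalWindowDoor`, crux `PoloidalWindowRigidity` (K2, stmt-NavierStokesRegularity-19708) —
# Tsai's Liouville-type Lemma 5.1 with a TANGENTIAL (rotational) drift

Cell ns-regularity-ideate, seat ns-poloidal-K2-p2 (stub-worker; `--supports` the crux, `--as helper`).  The rotated
Leray system of `…RotatedLeray` has drift `U + a y + βJy`; the tree's `isConst_of_driftOp_nonneg(_of_poly)`
(Tsai 1998 Lemma 5.1, Lemarié-Rieusset 2016 Lemma 16.8) asks the non-linear part of the drift to have linear rate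
`b < a`, which for `βJy` means `|β| < a`.  But `βJy` is SKEW: about every centre `x₀`,
`⟪y − x₀, βJy⟫ = ⟪y − x₀, βJx₀⟫`, and the whole proof of Lemma 16.8 only ever pairs the drift with `y − X₀` through
Gaussians centred at ONE point `X₀`.  Hence:

* `driftOp_gaussAt_add_skew` — on `gaussAt k x₀` the drift `U + T` (`T` skew linear) acts as `U + Tx₀`;
* `isConst_of_driftOp_nonneg_skew` — Lemma 5.1 with drift `U + T + a y`, `T` skew, `|U| ≤ M + b|y|`, `b < a`
  (the tree's proof verbatim, `M ↦ M + ‖TX₀‖`); `isConst_of_driftOp_nonneg_skew_of_poly` — polynomially bounded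
  `Θ`, `|U(y)| ≤ b|y|` for `|y| ≥ r₀`.

Used by `…RotatedLerayAllRates` to remove the restriction `|β| < a` (all rotation rates).

WHAT THIS IS NOT: not a claim about Navier–Stokes regularity — a maximum-principle lemma (bears_on LADDER-NS N0).
-/

noncomputable section

-- the summit and its single sub-problem share the name (CONVENTIONS §1), as in every Theorems file
set_option linter.dupNamespace false

namespace Summit.NavierStokesRegularity.NavierStokesRegularity.Theorems.PoloidalWindowDoorPoloidalWindowRigidityRotDriftLiouville

open MeasureTheory Set Function Filter Topology InnerProductSpace Metric
open scoped RealInnerProductSpace Laplacian ContDiff NNReal ENNReal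
open Literature.Analysis Literature.Analysis.FluidPDE

variable {E : Type*} [NormedAddCommGroup E] [InnerProductSpace ℝ E] [FiniteDimensional ℝ E]

/-- **A skew linear drift acts on centred Gaussians as a constant**: for `T` with `⟪Tw, w⟫ = 0`,
`driftOp ν a (U + T) (gaussAt k x₀) y = driftOp ν a (U + Tx₀) (gaussAt k x₀) y`
(`D gaussAt[w] ∝ ⟪y − x₀, w⟫` and `⟪y − x₀, T(y − x₀)⟫ = 0`). -/
theorem driftOp_gaussAt_add_skew (ν a : ℝ) (T : E →L[ℝ] E) (hT : ∀ w, ⟪T w, w⟫ = 0) {U W : E → E}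
    (hW : ∀ z, W z = U z + T z) (k : ℝ) (x₀ y : E) :
    driftOp ν a W (gaussAt k x₀) y = driftOp ν a (fun w => U w + T x₀) (gaussAt k x₀) y := by
  unfold driftOp
  rw [fderiv_gaussAt_apply, fderiv_gaussAt_apply, hW y]
  have h0 : ⟪y - x₀, T y⟫ = ⟪y - x₀, T x₀⟫ := by
    have h1 : ⟪y - x₀, T (y - x₀)⟫ = 0 := by rw [real_inner_comm]; exact hT _
    rw [map_sub, inner_sub_right] at h1
    linarith
  simp only [inner_add_right, h0]

/-- **Tsai's Liouville-type lemma with an additional TANGENTIAL (skew-linear) drift** (Tsai 1998, Lemma 5.1 /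
Lemarié-Rieusset Lemma 16.8, the tree's `isConst_of_driftOp_nonneg`, with the drift `U + T + a y`, `T` a skew
continuous linear map, `⟪Tw, w⟫ = 0`).  About every centre `x₀` one has `⟪y − x₀, Ty⟫ = ⟪y − x₀, Tx₀⟫`, so on the
Gaussians centred at `x₀` the drift acts like the affinely bounded field `U + Tx₀` (`driftOp_gaussAt_add_skew`) and
the tree's proof goes through VERBATIM with `M ↦ M + ‖Tx₀‖`; the subsolution hypothesis is on `Θ` with the full
drift.  Let `ν > 0`, `0 ≤ b < a`, `κ < (a − b)/(2ν)`, `Θ ∈ C²`, `ν ΔΘ − DΘ[U + T· + a·] ≥ 0`, `|U(y)| ≤ M + b|y|`,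
`|Θ(y)| ≤ C e^{κ|y|²}`.  Then `Θ` is constant. -/
theorem isConst_of_driftOp_nonneg_skew {ν a b M κ C : ℝ} (hν : 0 < ν) (hb : 0 ≤ b) (hba : b < a)
    (hκ : κ < (a - b) / (2 * ν)) {Θ : E → ℝ} {U W : E → E} (T : E →L[ℝ] E) (hT : ∀ w, ⟪T w, w⟫ = 0)
    (hW : ∀ z, W z = U z + T z) (hΘ : ContDiff ℝ 2 Θ)
    (hsub : ∀ y, 0 ≤ driftOp ν a W Θ y) (hU0 : ∀ y, ‖U y‖ ≤ M + b * ‖y‖)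
    (hgrowth : ∀ y, |Θ y| ≤ C * Real.exp (κ * ‖y‖ ^ 2)) (x y : E) : Θ x = Θ y := by
  -- reduce to: no pair `X₀, X₁` with `Θ X₀ < Θ X₁`
  suffices key : ∀ X₀ X₁ : E, ¬ (Θ X₀ < Θ X₁) by
    rcases lt_trichotomy (Θ x) (Θ y) with h | h | h
    · exact absurd h (key x y)
    · exact h
    · exact absurd h (key y x)
  intro X₀ X₁ hlt
  -- the drift about the centre `X₀`: `W = (U + T X₀) + T(· − X₀)`, the second part tangential
  have hM0 : 0 ≤ M := by
    have := hU0 0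
    rw [norm_zero, mul_zero, add_zero] at this
    exact (norm_nonneg _).trans this
  have hU : ∀ y, ‖U y + T X₀‖ ≤ (M + ‖T X₀‖) + b * ‖y‖ := fun y =>
    (norm_add_le _ _).trans (by linarith [hU0 y])
  have hshift : ∀ (k : ℝ) (z : E), driftOp ν a W (gaussAt k X₀) z =
      driftOp ν a (fun w => U w + T X₀) (gaussAt k X₀) z := fun k z =>
    driftOp_gaussAt_add_skew ν a T hT hW k X₀ z
  -- basic constants
  have ha : 0 < a := hb.trans_lt hba
  have hab : 0 < a - b := sub_pos.2 hba
  have hM : 0 ≤ M + ‖T X₀‖ := by positivity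
  have hC : 0 ≤ C := by
    have := hgrowth 0
    rw [norm_zero] at this
    norm_num at this
    exact (abs_nonneg _).trans this
  have hd0 : (0 : ℝ) ≤ (Module.finrank ℝ E : ℝ) := Nat.cast_nonneg _
  obtain ⟨δ, hδ0, hδ⟩ : ∃ δ : ℝ, 0 < δ ∧ Θ X₁ = Θ X₀ + δ := ⟨Θ X₁ - Θ X₀, sub_pos.2 hlt, by ring⟩
  have hX : X₁ ≠ X₀ := fun h => by rw [h] at hlt; exact lt_irrefl _ hlt
  have hs₁0 : 0 < ‖X₁ - X₀‖ := norm_pos_iff.2 (sub_ne_zero.2 hX)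
  obtain ⟨M₁, hM₁0, hM₁⟩ : ∃ M₁ : ℝ, 0 ≤ M₁ ∧ M₁ = (M + ‖T X₀‖) + (a + b) * ‖X₀‖ :=
    ⟨_, by positivity, rfl⟩
  have hΘc : Continuous Θ := hΘ.continuous
  -- `R₀`: a small ball about `X₀` on which `Θ ≤ Θ X₀ + δ/2`
  obtain ⟨R₀, hR₀0, hR₀s, hR₀Θ⟩ : ∃ R₀ : ℝ, 0 < R₀ ∧ R₀ < ‖X₁ - X₀‖ ∧
      ∀ y, ‖y - X₀‖ ≤ R₀ → Θ y ≤ Θ X₀ + δ / 2 := by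
    obtain ⟨η, hη0, hη⟩ := Metric.continuousAt_iff.1 hΘc.continuousAt (δ / 2) (half_pos hδ0)
    refine ⟨min (η / 2) (‖X₁ - X₀‖ / 2), lt_min (half_pos hη0) (half_pos hs₁0),
      (min_le_right _ _).trans_lt (half_lt_self hs₁0), fun y hy => ?_⟩
    have hdist : dist y X₀ < η := by
      rw [dist_eq_norm]; exact (hy.trans (min_le_left _ _)).trans_lt (half_lt_self hη0)
    have := hη hdist
    rw [Real.dist_eq] at this
    linarith [(abs_lt.1 this).2]
  -- `β` and the barrier `φ = exp(-β |y - X₀|²)`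
  obtain ⟨β, hβ0, hβeq⟩ : ∃ β : ℝ, 0 < β ∧
      4 * ν * β * R₀ ^ 2 = 2 * M₁ * R₀ + 2 * (Module.finrank ℝ E : ℝ) * ν + 1 := by
    refine ⟨(2 * M₁ * R₀ + 2 * (Module.finrank ℝ E : ℝ) * ν + 1) / (4 * ν * R₀ ^ 2),
      by positivity, ?_⟩
    field_simp
  obtain ⟨φ, hφ⟩ : ∃ φ : E → ℝ, φ = gaussAt (-β) X₀ := ⟨_, rfl⟩
  have hφ2 : ContDiff ℝ 2 φ := hφ ▸ contDiff_gaussAt _ _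
  have hφle1 : ∀ y, φ y ≤ 1 := fun y => hφ ▸ gaussAt_le_one_of_nonpos (by linarith) _ _
  have hφpos : ∀ y, 0 < φ y := fun y => hφ ▸ gaussAt_pos _ _ _
  have hφL : ∀ y, R₀ ≤ ‖y - X₀‖ → β * φ y ≤ driftOp ν a W φ y := by
    intro y hy
    have h1 := driftOp_gaussAt_neg_lower (ν := ν) hb hba.le hβ0.le hU X₀ y
    have hq := one_le_barrier_quad hν.le hM₁0 hd0 hR₀0 hβeq hy
    rw [← hM₁] at h1
    rw [hφ, hshift]
    refine le_trans ?_ h1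
    have h0 : 0 ≤ β * gaussAt (-β) X₀ y := mul_nonneg hβ0.le (gaussAt_pos _ _ _).le
    have := mul_le_mul_of_nonneg_left hq h0
    linarith
  -- `κ₁` and the penalisation `ψ = exp(κ₁ |y - X₀|²)`
  obtain ⟨κ₀, hκ₀0, hκκ₀, hκ₀lt⟩ : ∃ κ₀ : ℝ, 0 ≤ κ₀ ∧ κ ≤ κ₀ ∧ κ₀ < (a - b) / (2 * ν) :=
    ⟨max κ 0, le_max_right _ _, le_max_left _ _, max_lt hκ (by positivity)⟩
  obtain ⟨κ₁, hκ₀₁, hκ₁lt⟩ : ∃ κ₁ : ℝ, κ₀ < κ₁ ∧ κ₁ < (a - b) / (2 * ν) :=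
    ⟨(κ₀ + (a - b) / (2 * ν)) / 2, by linarith, by linarith⟩
  have hκ₁0 : 0 < κ₁ := hκ₀0.trans_lt hκ₀₁
  obtain ⟨B, hB0, hB⟩ : ∃ B : ℝ, 0 < B ∧ B = 2 * (a - b) - 4 * ν * κ₁ := by
    refine ⟨_, ?_, rfl⟩
    have : 4 * ν * κ₁ < 4 * ν * ((a - b) / (2 * ν)) := by gcongr
    have e : 4 * ν * ((a - b) / (2 * ν)) = 2 * (a - b) := by field_simp; ring
    linarith
  obtain ⟨R₁, hR₁1, hR₁s, hR₁B⟩ : ∃ R₁ : ℝ, 1 ≤ R₁ ∧ ‖X₁ - X₀‖ + 1 ≤ R₁ ∧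
      (2 * M₁ + 2 * (Module.finrank ℝ E : ℝ) * ν + 1) / B ≤ R₁ :=
    ⟨max (max 1 (‖X₁ - X₀‖ + 1)) ((2 * M₁ + 2 * (Module.finrank ℝ E : ℝ) * ν + 1) / B),
      (le_max_left _ _).trans (le_max_left _ _), (le_max_right _ _).trans (le_max_left _ _),
      le_max_right _ _⟩
  have hR₀R₁ : R₀ < R₁ := by linarith
  have hs₁R₁ : ‖X₁ - X₀‖ ≤ R₁ := by linarith
  obtain ⟨ψ, hψ⟩ : ∃ ψ : E → ℝ, ψ = gaussAt κ₁ X₀ := ⟨_, rfl⟩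
  have hψ2 : ContDiff ℝ 2 ψ := hψ ▸ contDiff_gaussAt _ _
  have hψpos : ∀ y, 0 < ψ y := fun y => hψ ▸ gaussAt_pos _ _ _
  have hψle : ∀ y, ‖y - X₀‖ ≤ R₁ → ψ y ≤ Real.exp (κ₁ * R₁ ^ 2) := fun y hy =>
    hψ ▸ gaussAt_mono_radius hκ₁0.le _ hy
  have hψeq : ∀ y, ψ y = Real.exp (κ₁ * ‖y - X₀‖ ^ 2) := fun y => by rw [hψ]; rfl
  have hψL_far : ∀ y, R₁ ≤ ‖y - X₀‖ → driftOp ν a W ψ y ≤ -(κ₁ * ψ y) := by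
    intro y hy
    have h1 := driftOp_gaussAt_upper (ν := ν) hb hba.le hκ₁0.le hU X₀ y
    rw [← hM₁, ← hB] at h1
    have hBr : 2 * M₁ + 2 * (Module.finrank ℝ E : ℝ) * ν + 1 ≤ B * ‖y - X₀‖ := by
      have := (div_le_iff₀ hB0).1 (hR₁B.trans hy)
      nlinarith
    have hq := one_le_penal_quad hν.le hd0 (hR₁1.trans hy) hBr
    rw [hψ, hshift]
    refine h1.trans ?_
    have h0 : 0 ≤ κ₁ * gaussAt κ₁ X₀ y := mul_nonneg hκ₁0.le (gaussAt_pos _ _ _).le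
    have := mul_le_mul_of_nonneg_left hq h0
    linarith
  obtain ⟨K, hK0, hK⟩ : ∃ K : ℝ, 0 ≤ K ∧ K = κ₁ * Real.exp (κ₁ * R₁ ^ 2) *
      (4 * ν * κ₁ * R₁ ^ 2 + 2 * (Module.finrank ℝ E : ℝ) * ν +
        2 * (M₁ + (a + b) * R₁) * R₁) := ⟨_, by positivity, rfl⟩
  have hψL_near : ∀ y, ‖y - X₀‖ ≤ R₁ → |driftOp ν a W ψ y| ≤ K := by
    intro y hy
    have h1 := abs_driftOp_gaussAt_le hν.le hb hba.le hκ₁0.le hU X₀ y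
    rw [← hM₁] at h1
    rw [hψ, hshift]
    refine h1.trans ?_
    rw [hK]
    have hr0 : 0 ≤ ‖y - X₀‖ := norm_nonneg _
    gcongr
    exact gaussAt_mono_radius hκ₁0.le _ hy
  -- the constants `γ`, `α` and the auxiliary function `V = Θ + α (φ - γ ψ)`
  obtain ⟨Φm, hΦm0, hφL_mid⟩ : ∃ Φm : ℝ, 0 < Φm ∧
      ∀ y, R₀ ≤ ‖y - X₀‖ → ‖y - X₀‖ ≤ R₁ → Φm ≤ driftOp ν a W φ y := by
    refine ⟨β * Real.exp (-β * R₁ ^ 2), by positivity, fun y hy hy' => ?_⟩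
    refine le_trans ?_ (hφL y hy)
    rw [hφ]
    exact mul_le_mul_of_nonneg_left (gaussAt_anti_radius (by linarith) X₀ hy') hβ0.le
  obtain ⟨γ, hγ0, hγK⟩ : ∃ γ : ℝ, 0 < γ ∧ γ * K < Φm := by
    refine ⟨Φm / (2 * (K + 1)), by positivity, ?_⟩
    rw [div_mul_eq_mul_div, div_lt_iff₀ (by positivity)]
    nlinarith
  obtain ⟨S, hS0, hS⟩ : ∃ S : ℝ, 0 < S ∧ S = 1 + γ * Real.exp (κ₁ * R₁ ^ 2) :=
    ⟨_, by positivity, rfl⟩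
  have hφψ : ∀ y, ‖y - X₀‖ ≤ R₁ → |φ y - γ * ψ y| ≤ S := by
    intro y hy
    refine (abs_sub _ _).trans ?_
    rw [abs_of_pos (hφpos y), abs_of_pos (mul_pos hγ0 (hψpos y)), hS]
    gcongr
    · exact hφle1 y
    · exact hψle y hy
  obtain ⟨α, hα0, hαS⟩ : ∃ α : ℝ, 0 < α ∧ α * S = δ / 8 :=
    ⟨δ / (8 * S), by positivity, by field_simp⟩
  obtain ⟨V, hV⟩ : ∃ V : E → ℝ, V = Θ + α • (φ - γ • ψ) := ⟨_, rfl⟩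
  have hVapply : ∀ y, V y = Θ y + α * (φ y - γ * ψ y) := fun y => by
    simp only [hV, Pi.add_apply, Pi.smul_apply, Pi.sub_apply, smul_eq_mul]
  have hV2 : ContDiff ℝ 2 V :=
    hV ▸ hΘ.add (contDiff_const.smul (hφ2.sub (contDiff_const.smul hψ2)))
  have hLV : ∀ y, driftOp ν a W V y =
      driftOp ν a W Θ y + α * (driftOp ν a W φ y - γ * driftOp ν a W ψ y) := fun y =>
    hV ▸ driftOp_add_smul_sub ν a W hΘ hφ2 hψ2 α γ y
  -- `V X₁` is large, `V` is small on the small ball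
  have hVX₁ : Θ X₀ + 7 * δ / 8 ≤ V X₁ := by
    rw [hVapply]
    have h1 := hφψ X₁ hs₁R₁
    have h2 : -S ≤ φ X₁ - γ * ψ X₁ := (neg_le_neg h1).trans (neg_abs_le _)
    have h3 := mul_le_mul_of_nonneg_left h2 hα0.le
    rw [mul_neg, hαS] at h3
    linarith
  have hVsmall : ∀ y, ‖y - X₀‖ ≤ R₀ → V y < V X₁ := by
    intro y hy
    rw [hVapply]
    have h1 := hφψ y (hy.trans hR₀R₁.le)
    have h2 : φ y - γ * ψ y ≤ S := (le_abs_self _).trans h1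
    have h3 := mul_le_mul_of_nonneg_left h2 hα0.le
    rw [hαS] at h3
    have h4 := hR₀Θ y hy
    linarith
  -- decay at infinity: `V ≤ V X₁` outside a large ball
  obtain ⟨R₂, hR₁R₂, hVfar⟩ : ∃ R₂ : ℝ, R₁ ≤ R₂ ∧ ∀ y, R₂ ≤ ‖y - X₀‖ → V y ≤ V X₁ :=
    le_far_of_gauss_penalisation hC hgrowth hκκ₀ hκ₀0 hκ₀₁ hκ₁0 hψeq hφle1 hα0 hγ0
      hVapply X₁ R₁
  -- a global maximum `X₂` of `V`, where `L V ≤ 0`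
  obtain ⟨X₂, hX₂⟩ : ∃ X₂, ∀ y, V y ≤ V X₂ :=
    exists_forall_le_of_le_outside hV2.continuous (hs₁R₁.trans hR₁R₂) hVfar
  have hLV2 : driftOp ν a W V X₂ ≤ 0 := driftOp_nonpos_of_isMax hν.le W hV2 hX₂
  rw [hLV] at hLV2
  have hΘ2 := hsub X₂
  -- case analysis on the position of `X₂`
  rcases le_or_gt ‖X₂ - X₀‖ R₀ with h1 | h1
  · exact absurd (hX₂ X₁) (not_le.2 (hVsmall X₂ h1))
  have hpos : 0 < driftOp ν a W φ X₂ - γ * driftOp ν a W ψ X₂ := by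
    rcases le_or_gt ‖X₂ - X₀‖ R₁ with h2 | h2
    · have hφ2' := hφL_mid X₂ h1.le h2
      have hψ2' := (le_abs_self _).trans (hψL_near X₂ h2)
      have := mul_le_mul_of_nonneg_left hψ2' hγ0.le
      linarith
    · have hφ2' := hφL X₂ (hR₀R₁.le.trans h2.le)
      have hψ2' := hψL_far X₂ h2.le
      have e1 := mul_pos hβ0 (hφpos X₂)
      have e2 := mul_pos hγ0 (mul_pos hκ₁0 (hψpos X₂))
      have := mul_le_mul_of_nonneg_left hψ2' hγ0.le
      have e3 : γ * -(κ₁ * ψ X₂) = -(γ * (κ₁ * ψ X₂)) := by ring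
      linarith
  have := mul_pos hα0 hpos
  linarith


/-- **The polynomial-growth form** (Tsai's use on p. 48): `U` continuous with `|U(y)| ≤ b|y|` for `|y| ≥ r₀`,
`0 ≤ b < a`, `T` skew, `Θ ∈ C²` a subsolution for the drift `U + T + a y` with `|Θ(y)| ≤ C(1 + |y|)^N` ⇒ `Θ` constant. -/
theorem isConst_of_driftOp_nonneg_skew_of_poly {ν a b C r₀ : ℝ} {N : ℕ} (hν : 0 < ν) (hb : 0 ≤ b)
    (hba : b < a) {Θ : E → ℝ} {U W : E → E} (T : E →L[ℝ] E) (hT : ∀ w, ⟪T w, w⟫ = 0)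
    (hW : ∀ z, W z = U z + T z) (hΘ : ContDiff ℝ 2 Θ) (hUc : Continuous U)
    (hsub : ∀ y, 0 ≤ driftOp ν a W Θ y) (hU : ∀ y, r₀ ≤ ‖y‖ → ‖U y‖ ≤ b * ‖y‖)
    (hgrowth : ∀ y, |Θ y| ≤ C * (1 + ‖y‖) ^ N) (x y : E) : Θ x = Θ y := by
  have hC : 0 ≤ C := by
    have h := (abs_nonneg _).trans (hgrowth 0)
    rw [norm_zero, add_zero, one_pow, mul_one] at h
    exact h
  obtain ⟨M, -, hM⟩ := exists_affine_bound_of_eventually_le hUc hU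
  -- a Gaussian rate `κ = (a - b)/(4ν) < (a - b)/(2ν)`
  set κ := (a - b) / (4 * ν) with hκ
  have hab : 0 < a - b := sub_pos.2 hba
  have hκ0 : 0 < κ := by positivity
  have hκlt : κ < (a - b) / (2 * ν) := by
    rw [hκ, div_lt_div_iff₀ (by positivity) (by positivity)]
    nlinarith
  refine isConst_of_driftOp_nonneg_skew (C := C * (N.factorial * Real.exp (1 + 1 / (4 * κ)))) hν hb hba hκlt T hT
    hW hΘ hsub hM (fun z => (hgrowth z).trans ?_) x y
  rw [mul_assoc]
  exact mul_le_mul_of_nonneg_left (one_add_pow_le_exp_mul_sq hκ0 N (norm_nonneg z)) hC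

end Summit.NavierStokesRegularity.NavierStokesRegularity.Theorems.PoloidalWindowDoorPoloidalWindowRigidityRotDriftLiouville

end
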